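import Summits.CriticalPhenomena.PercolationContinuityZ3.Theorems.PercNearOneGluingNoHeavyQuantGatedConvCone
import Summits.CriticalPhenomena.PercolationContinuityZ3.Theorems.PercNearOneGluingNoHeavyQuantLawDecSingleLow
import HarnessLib

/-!
# QUANT lane R8, T-DEC: Conjecture R (`LawDec.GatedShiftDEC`) WITHOUT ANY HYPOTHESIS ON THE FOREST when the root carries enough sure relays
# (`k ≥ Q·mean`, or `μ 0 = 0` and `2·h_min + k ≥ Q·mean`): the gated shifted law is single-low, hence DEC by census-2 g53's dichotomy

builds on p205010 (kernel theorem, internal audit signed; external expert review pending)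

Support file (`--supports stmt-CriticalPhenomena-4575`), QUANT lane typer seat prim-quant-stmt (gen 25), rung R8 of
`run/shared/lean/prim/quant/LADDER.md`; memo `run/shared/lean/prim/quant/prim-quant-stmt-g25/GATE-INTERACTION-G25.md` §4/§6.  Theorems only,
standard axioms, no sorries.  Uses census-2 g53's single-low-atom dichotomy `LawDec.decAt_of_lowsOnlyZero` (`…QuantLawDecSingleLow`: a
top-affordable law whose only charged low atom below the layer is `0` is DEC(j′) — criterion E or the empty-atom criterion), `SDECUpTo`,
`gate_laws` (typer g25) and `lconv_point_left` (`…QuantGatedConvCone`).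

THE OBSERVATION.  The law of Conjecture R is `L = gate_q(μ(· − k))` on `{0..k+M}` with mean `q(T + k)` (`T` the mean of `μ`): its charged atoms
are `0`, `k` (if `μ 0 > 0`) and `h + k` (`μ h > 0`, `h ≥ 1`).  If `2(h + k) ≥ q(T + k)` for every charged `h ≥ 1` and `2k ≥ q(T + k)` when
`μ 0 > 0`, then `0` is the ONLY low atom of `L` at every layer, and `L` is top-affordable at floor `qx` as soon as `μ` is at `x` (`x ≤ 1`); so
`decAt_of_lowsOnlyZero` gives DEC at every layer `j < k + M`, for every gate `q ≤ Q` — WITHOUT any DEC hypothesis on `μ`.  Since `q ≤ Q ≤ 1`, the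
conditions follow from `2·h + k ≥ Q·T` for every charged `h ≥ 1` and `k ≥ Q·T` if `μ 0 > 0`; in particular from `k ≥ Q·T` alone ("a root
vertex carrying at least `Q·mean` sure relays").  This complements `…QuantGatedShiftSubMean` (no atom strictly between mean and top; e.g. all
blob laws), which is proved by the shift transport instead.

* **`LawDec.gatedShift_sdecUpTo_singleLow`** — `0 < x ≤ 1`, `Q ≤ 1`, `Q·x < 1`, `k ≥ 1`, `μ` a top-affordable probability law on `{0..M}` with
  `2h + k ≥ Q·T` on its charged atoms `h ≥ 1` and `k ≥ Q·T` if `μ 0 > 0` ⟹ `SDECUpTo x Q (k + M) (μ(· − k))`.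
* **`LawDec.gatedShift_sdecUpTo_of_many_relays`** — the case `k ≥ Q·T`, any `μ`.
* `LawDec.gatedShiftDEC_singleLow` / `gatedShiftDEC_of_many_relays` — the same for `lconv k M δ_k μ`, the literal law of `GatedShiftDEC`.

HONEST STATUS: `GatedShiftDEC` in general, `GatedConvEmptyFree`, `GatedConvClosedTMean`, `ConvClosedT`, `SDECConvClosed` remain OPEN.
[this work]; the dichotomy: prim-quant-census-2 g52/g53 (this lane).  The gluing rows served [cite: KozmaNitzan2024, Conjecture 3 (p. 15)];
product measure [cite: Grimmett1999, §1.3 p. 10].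
-/

noncomputable section

namespace Summit.CriticalPhenomena.PercolationContinuityZ3.Theorems

namespace Quant

open Finset

namespace LawDec

/-- **Conjecture R without hypotheses on the forest, single-low regime.**  `0 < x ≤ 1`, `Q ≤ 1`, `Q·x < 1`, `k ≥ 1`; `μ ≥ 0` a law on
`{0..M}` of mass `1` with mean `T`, top-affordable (`x·M ≤ T`), such that every charged atom `h ≥ 1` has `2h + k ≥ Q·T` and, if `μ 0 > 0`,
`k ≥ Q·T`.  Then for every gate `0 < q ≤ Q` and every layer `j < k + M` the gated shifted law `gate (μ(· − k)) q` is DEC(j) at floor `q·x`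
(its only low atom is `0`; `decAt_of_lowsOnlyZero`). [this work] -/
theorem gatedShift_sdecUpTo_singleLow (x Q : ℝ) (k M : ℕ) (μ : ℕ → ℝ) (hx0 : 0 < x) (hx1 : x ≤ 1) (hQ1 : Q ≤ 1)
    (hQx : Q * x < 1) (hk : 1 ≤ k) (hμ0 : ∀ h, 0 ≤ μ h) (hμM : ∀ h, M < h → μ h = 0) (hμ1 : ∑ h ∈ Finset.range (M + 1), μ h = 1)
    (hta : x * (M : ℝ) ≤ ∑ h ∈ Finset.range (M + 1), (h : ℝ) * μ h)
    (hmin : ∀ h, 1 ≤ h → 0 < μ h → Q * (∑ t ∈ Finset.range (M + 1), (t : ℝ) * μ t) ≤ 2 * (h : ℝ) + k)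
    (hzero : 0 < μ 0 → Q * (∑ t ∈ Finset.range (M + 1), (t : ℝ) * μ t) ≤ k) :
    SDECUpTo x Q (k + M) (fun t => if k ≤ t then μ (t - k) else 0) := by
  intro q hq0 hqQ j hj
  set T : ℝ := ∑ t ∈ Finset.range (M + 1), (t : ℝ) * μ t with hT
  set y : ℝ := q * x with hy
  have hq1 : q ≤ 1 := hqQ.trans hQ1
  have hy0 : 0 < y := mul_pos hq0 hx0
  have hy1 : y < 1 := lt_of_le_of_lt (mul_le_mul_of_nonneg_right hqQ hx0.le) hQx
  have hT0 : 0 ≤ T := Finset.sum_nonneg fun t _ => mul_nonneg (Nat.cast_nonneg t) (hμ0 t)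
  set sh : ℕ → ℝ := fun t => if k ≤ t then μ (t - k) else 0 with hsh
  -- law facts of the shifted law and of its gate
  have s0 : ∀ t, 0 ≤ sh t := fun t => by simp only [hsh]; split_ifs; exacts [hμ0 _, le_rfl]
  have sM : ∀ t, k + M < t → sh t = 0 := fun t ht => by
    simp only [hsh]; split_ifs
    · exact hμM _ (by omega)
    · rfl
  have reindex : ∀ g : ℕ → ℝ, ∑ t ∈ Finset.range (k + M + 1), (if k ≤ t then g (t - k) else 0) = ∑ h ∈ Finset.range (M + 1), g h := by
    intro g
    rw [show k + M + 1 = k + (M + 1) by omega, Finset.sum_range_add]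
    rw [Finset.sum_eq_zero (fun t ht => if_neg (by have := Finset.mem_range.1 ht; omega)), zero_add]
    exact Finset.sum_congr rfl fun h _ => by rw [if_pos (by omega), Nat.add_sub_cancel_left]
  have s1 : ∑ t ∈ Finset.range (k + M + 1), sh t = 1 := by simp only [hsh]; rw [reindex, hμ1]
  have smean : ∑ t ∈ Finset.range (k + M + 1), (t : ℝ) * sh t = T + k := by
    have e : ∀ t : ℕ, (t : ℝ) * sh t = (if k ≤ t then (((t - k : ℕ) : ℝ) + k) * μ (t - k) else 0) := by
      intro t; simp only [hsh]
      split_ifs with hkt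
      · rw [show ((t - k : ℕ) : ℝ) + k = t by push_cast [Nat.cast_sub hkt]; ring]
      · rw [mul_zero]
    simp_rw [e]
    rw [reindex (fun h => ((h : ℝ) + k) * μ h)]
    simp only [add_mul]
    rw [Finset.sum_add_distrib, ← Finset.mul_sum, hμ1, mul_one]
  obtain ⟨L0, LM, L1⟩ := gate_laws (k + M) sh q hq0.le hq1 s0 sM s1
  have Lmean : ∑ t ∈ Finset.range (k + M + 1), (t : ℝ) * gate sh q t = q * (T + k) := by rw [sum_mul_gate, smean]
  have hkR : (1 : ℝ) ≤ k := by exact_mod_cast hk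
  -- top-affordability of the gated shifted law at floor `y`
  have htopL : y * ((k + M : ℕ) : ℝ) ≤ q * (T + k) := by
    push_cast
    rw [hy]
    have : q * (x * (M : ℝ)) ≤ q * T := mul_le_mul_of_nonneg_left hta hq0.le
    nlinarith [mul_nonneg hq0.le (Nat.cast_nonneg k)]
  refine decAt_of_lowsOnlyZero y j (k + M) (k + M) (gate sh q) hj L0 LM L1 hy0 hy1 ?_ (fun h _ hh => ?_) ?_ ?_
  · -- every charged atom is affordable
    intro h hh
    have hhM : h ≤ k + M := by
      by_contra hc; exact absurd (LM h (not_le.1 hc)) (ne_of_gt hh)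
    rw [Lmean]
    have : y * (h : ℝ) ≤ y * ((k + M : ℕ) : ℝ) := mul_le_mul_of_nonneg_left (by exact_mod_cast hhM) hy0.le
    linarith
  · by_contra hc; exact absurd (LM h (not_le.1 hc)) (ne_of_gt hh)
  · rw [Lmean]; exact htopL
  · -- no positive low atom: the charged atoms `h' > 0` are `k` (if `μ 0 > 0`) and `h + k` with `μ h > 0`
    intro h' hpos _ hch
    rw [Lmean]
    rw [gate_apply, if_neg (by omega : h' ≠ 0), mul_zero, add_zero] at hch
    have hsh' : 0 < sh h' := pos_of_mul_pos_right hch hq0.le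
    simp only [hsh] at hsh'
    by_cases hkh : k ≤ h'
    · rw [if_pos hkh] at hsh'
      have hcast : ((h' : ℕ) : ℝ) = ((h' - k : ℕ) : ℝ) + k := by push_cast [Nat.cast_sub hkh]; ring
      by_cases hz : h' - k = 0
      · -- the atom `k` itself
        rw [hz] at hsh'
        have := hzero hsh'
        have hh'k : (h' : ℝ) = k := by rw [hcast, hz]; simp
        rw [hh'k]
        nlinarith [mul_le_mul_of_nonneg_right hqQ hT0, mul_nonneg hq0.le (Nat.cast_nonneg k)]
      · have := hmin (h' - k) (by omega) hsh'
        rw [hcast]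
        nlinarith [mul_le_mul_of_nonneg_right hqQ hT0, mul_nonneg hq0.le (Nat.cast_nonneg k)]
    · rw [if_neg hkh] at hsh'; exact absurd hsh' (lt_irrefl 0)

/-- **"many sure relays": `k ≥ Q·mean μ` makes the gated shift DEC at every layer and every gate `≤ Q`, for ANY top-affordable forest law `μ`.**
[this work] -/
theorem gatedShift_sdecUpTo_of_many_relays (x Q : ℝ) (k M : ℕ) (μ : ℕ → ℝ) (hx0 : 0 < x) (hx1 : x ≤ 1) (hQ1 : Q ≤ 1)
    (hQx : Q * x < 1) (hk : 1 ≤ k) (hμ0 : ∀ h, 0 ≤ μ h) (hμM : ∀ h, M < h → μ h = 0) (hμ1 : ∑ h ∈ Finset.range (M + 1), μ h = 1)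
    (hta : x * (M : ℝ) ≤ ∑ h ∈ Finset.range (M + 1), (h : ℝ) * μ h)
    (hmany : Q * (∑ t ∈ Finset.range (M + 1), (t : ℝ) * μ t) ≤ k) :
    SDECUpTo x Q (k + M) (fun t => if k ≤ t then μ (t - k) else 0) :=
  gatedShift_sdecUpTo_singleLow x Q k M μ hx0 hx1 hQ1 hQx hk hμ0 hμM hμ1 hta
    (fun h _ _ => by linarith [(Nat.cast_nonneg h : (0 : ℝ) ≤ h)]) (fun _ => hmany)

/-- **Conjecture R (`GatedShiftDEC`) in its own vocabulary, single-low regime** (`lconv k M δ_k μ = μ(· − k)` by `lconv_point_left`). [this work] -/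
theorem gatedShiftDEC_singleLow (x Q : ℝ) (k M : ℕ) (μ : ℕ → ℝ) (hx0 : 0 < x) (hx1 : x ≤ 1) (hQ1 : Q ≤ 1)
    (hQx : Q * x < 1) (hk : 1 ≤ k) (hμ0 : ∀ h, 0 ≤ μ h) (hμM : ∀ h, M < h → μ h = 0) (hμ1 : ∑ h ∈ Finset.range (M + 1), μ h = 1)
    (hta : x * (M : ℝ) ≤ ∑ h ∈ Finset.range (M + 1), (h : ℝ) * μ h)
    (hmin : ∀ h, 1 ≤ h → 0 < μ h → Q * (∑ t ∈ Finset.range (M + 1), (t : ℝ) * μ t) ≤ 2 * (h : ℝ) + k)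
    (hzero : 0 < μ 0 → Q * (∑ t ∈ Finset.range (M + 1), (t : ℝ) * μ t) ≤ k) :
    SDECUpTo x Q (k + M) (lconv k M (fun i => if i = k then (1 : ℝ) else 0) μ) := by
  have e : lconv k M (fun i => if i = k then (1 : ℝ) else 0) μ = fun t => if k ≤ t then μ (t - k) else 0 :=
    funext fun t => lconv_point_left k M μ hμM t
  rw [e]
  exact gatedShift_sdecUpTo_singleLow x Q k M μ hx0 hx1 hQ1 hQx hk hμ0 hμM hμ1 hta hmin hzero

/-- **Conjecture R (`GatedShiftDEC`) for `k ≥ Q·mean μ` sure relays, any top-affordable `μ`, in its own vocabulary.** [this work] -/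
theorem gatedShiftDEC_of_many_relays (x Q : ℝ) (k M : ℕ) (μ : ℕ → ℝ) (hx0 : 0 < x) (hx1 : x ≤ 1) (hQ1 : Q ≤ 1)
    (hQx : Q * x < 1) (hk : 1 ≤ k) (hμ0 : ∀ h, 0 ≤ μ h) (hμM : ∀ h, M < h → μ h = 0) (hμ1 : ∑ h ∈ Finset.range (M + 1), μ h = 1)
    (hta : x * (M : ℝ) ≤ ∑ h ∈ Finset.range (M + 1), (h : ℝ) * μ h)
    (hmany : Q * (∑ t ∈ Finset.range (M + 1), (t : ℝ) * μ t) ≤ k) :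
    SDECUpTo x Q (k + M) (lconv k M (fun i => if i = k then (1 : ℝ) else 0) μ) := by
  have e : lconv k M (fun i => if i = k then (1 : ℝ) else 0) μ = fun t => if k ≤ t then μ (t - k) else 0 :=
    funext fun t => lconv_point_left k M μ hμM t
  rw [e]
  exact gatedShift_sdecUpTo_of_many_relays x Q k M μ hx0 hx1 hQ1 hQx hk hμ0 hμM hμ1 hta hmany

end LawDec

end Quant

end Summit.CriticalPhenomena.PercolationContinuityZ3.Theorems
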